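import Summits.QuantumFields.BalabanUV.T4Continuum.Support.NE7FirstVariationLocality
import Summits.QuantumFields.BalabanUV.T4Continuum.Support.NE3EnergyHessBilin
import HarnessLib

/-!
# NE7CutoffCurlLeibniz — THE CUTOFF LEIBNIZ RULE FOR THE DRESSED CURL (torus road to [Balaban1985Variational] Prop. 8, memo §7, brick (N2), second half): for a
# bondwise real weight `c` (the cutoff `χ` of the torus road) and a direction `Y`, `d_V(c·Y)(p) = c(b₀)·d_V Y(p) + R(p)` EXACTLY, where `b₀` is the first bond of the
# plaquette and the remainder `R` is a sum of three transported bond values of `Y` weighted by DIFFERENCES of `c` across the plaquette — so `‖R‖ ≤ osc_p(c)·Σ‖Y(b)‖`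
# at a unitary background: the commutator `[d_V, χ]` costs `‖∇χ‖ ≲ 1∕(RM)`, never a derivative of `Y`

Cell `pub-balaban`, rung (B)+1 sub-cell t4, lineage `b2b-balaban-t4-ne7-p1` (CRUX PROVER NE7 #1 = OWNER of row NE7), generation 88; memo
`t4/b2b-balaban-t4-ne7-p1-g88/EXISTENCE-BY-INDUCTION.md` §7 (T3).  File F248 (over F247 `NE7FirstVariationLocality`, row NE3's `NE3EnergyHessBilin.Ad_real_smul`,
`AveragingDeficitTransport.norm_Ad_of_unitary`).

WHY.  The torus road cuts the local Landau chart `A` off with `χ` and runs the FLAT machinery on `χ·A`; every letter of F245∕F246 then carries commutator terms in which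
the lattice derivative falls on `χ` instead of `A` — priced in memo §7 as `(∇χ)(∇A) + (∇²χ)A`, `1∕R`-small after the slice solver.  The basic identity behind all of
them is this file's: the dressed curl of a weighted direction is the weight times the dressed curl plus weight-DIFFERENCES times transported bond values.
WHAT ([folklore] lattice algebra; 0 def, 0 sorry).
§1 `isSkewDir_weight` (a real bondwise weight keeps directions skew), **`curlAt_weight_eq`** (the exact Leibniz identity), `curlAt_weight_eq_of_const` (a weight constant on
   the plaquette factors out).
§2 **`norm_curlAt_weight_sub_le`** — at a unitary background, `‖d_V(c·Y)(p) − c(z,μ)·d_V Y(p)‖ ≤ ω·(‖Y(z+e_μ,ν)‖ + ‖Y(z+e_ν,μ)‖ + ‖Y(z,ν)‖)` whenever the three other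
   weights differ from `c(z,μ)` by at most `ω`; `norm_curlAt_weight_le` — hence `‖d_V(c·Y)(p)‖ ≤ |c(z,μ)|·‖d_V Y(p)‖ + ω·(…)`.
HONEST FRAMING (page 1): finite lattice algebra; nothing analytic, nothing of Bałaban's asserted; NOT (APE), NOT ONE-STEP, NOT NE7; spine 0∕9; finite T⁴ rung (B)+1 —
NOT infinite volume, NOT mass gap, NOT `BetaPertH`, NOT Clay.  Continuum YM on T⁴ ⇐ BetaPertH ∧ nine spine estimates (0/9 proved); BetaPertH ⇐ (D1) ∧ (D4) ∧ CAP+tail;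
G-an2-4 gates asym, D1 and NE2/3/4.
-/

set_option autoImplicit false

open scoped BigOperators Matrix.Norms.L2Operator
open NormedSpace Finset

namespace Summit.QuantumFields.BalabanUV.T4Continuum.NE7CutoffCurlLeibniz

open Literature.MathematicalPhysics.QuantumFieldTheory.Balaban1983to89
open B7Prop1Explicit B7Prop2Explicit UnitaryModel
open T4AveragingDeficitWall (IsUnitaryCfg IsSkewDir Ad curlAt)
open AveragingDeficitTransport (norm_Ad_of_unitary)
open NE3EnergyHessBilin (Ad_real_smul)

noncomputable section

variable {d : ℕ} {n : Type*} [Fintype n] [DecidableEq n]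

/-! ## §1 The exact Leibniz identity -/

omit [Fintype n] [DecidableEq n] in
/-- A real bondwise weight keeps a skew direction skew. [folklore] -/
theorem isSkewDir_weight (c : Site d → Fin d → ℝ) {Y : Site d → Fin d → Matrix n n ℂ} (hY : IsSkewDir Y) :
    IsSkewDir (fun y κ => c y κ • Y y κ) := fun y κ => skewAdjoint.smul_mem (c y κ) (hY y κ)

/-- **THE CUTOFF LEIBNIZ RULE FOR THE DRESSED CURL** (exact): with `b₀ = (z, μ)` the first bond of the plaquette `p_{μν}(z)`,
`d_V(c·Y)(p) = c(b₀)·d_V Y(p) + (c(z+e_μ,ν) − c(b₀))·Ad Y(z+e_μ,ν) − (c(z+e_ν,μ) − c(b₀))·Ad Y(z+e_ν,μ) − (c(z,ν) − c(b₀))·Ad Y(z,ν)` (the transports `Ad` being those of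
`curlAt`). [folklore] -/
theorem curlAt_weight_eq (V : Site d → Fin d → (Matrix n n ℂ)ˣ) (c : Site d → Fin d → ℝ) (Y : Site d → Fin d → Matrix n n ℂ) (z : Site d) (μ ν : Fin d) :
    curlAt V (fun y κ => c y κ • Y y κ) z μ ν
      = c z μ • curlAt V Y z μ ν
        + ((c (z + e μ) ν - c z μ) • Ad (V z μ * V (z + e μ) ν) (Y (z + e μ) ν)
          - (c (z + e ν) μ - c z μ) • Ad (V z μ * V (z + e μ) ν) (Y (z + e ν) μ)
          - (c z ν - c z μ) • Ad (V z μ * V (z + e μ) ν * (V (z + e ν) μ)⁻¹) (Y z ν)) := by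
  simp only [curlAt, Ad_real_smul, smul_add, smul_sub, sub_smul]
  abel

/-- A weight that is CONSTANT on the four bonds of the plaquette factors out of the dressed curl. [folklore] -/
theorem curlAt_weight_eq_of_const (V : Site d → Fin d → (Matrix n n ℂ)ˣ) (c : Site d → Fin d → ℝ) (Y : Site d → Fin d → Matrix n n ℂ) (z : Site d)
    (μ ν : Fin d) (h2 : c (z + e μ) ν = c z μ) (h3 : c (z + e ν) μ = c z μ) (h4 : c z ν = c z μ) :
    curlAt V (fun y κ => c y κ • Y y κ) z μ ν = c z μ • curlAt V Y z μ ν := by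
  rw [curlAt_weight_eq, h2, h3, h4]
  simp

/-! ## §2 The commutator bound at a unitary background -/

/-- **THE COMMUTATOR `[d_V, χ]` COSTS THE OSCILLATION OF `χ` OVER THE PLAQUETTE, NOT A DERIVATIVE OF `Y`**: at a unitary `V`, if the weights of the three other
bonds of the plaquette differ from `c(z,μ)` by at most `ω`, then `‖d_V(c·Y)(p) − c(z,μ)·d_V Y(p)‖ ≤ ω·(‖Y(z+e_μ,ν)‖ + ‖Y(z+e_ν,μ)‖ + ‖Y(z,ν)‖)`. [folklore] -/
theorem norm_curlAt_weight_sub_le [Nonempty n] {V : Site d → Fin d → (Matrix n n ℂ)ˣ} (hV : IsUnitaryCfg V) (c : Site d → Fin d → ℝ)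
    (Y : Site d → Fin d → Matrix n n ℂ) (z : Site d) (μ ν : Fin d) {ω : ℝ}
    (h2 : |c (z + e μ) ν - c z μ| ≤ ω) (h3 : |c (z + e ν) μ - c z μ| ≤ ω) (h4 : |c z ν - c z μ| ≤ ω) :
    ‖curlAt V (fun y κ => c y κ • Y y κ) z μ ν - c z μ • curlAt V Y z μ ν‖
      ≤ ω * (‖Y (z + e μ) ν‖ + ‖Y (z + e ν) μ‖ + ‖Y z ν‖) := by
  have hω : 0 ≤ ω := (abs_nonneg _).trans h2
  have hu1 : V z μ * V (z + e μ) ν ∈ unitaryUnits (Matrix n n ℂ) := (unitaryUnits (Matrix n n ℂ)).mul_mem (hV _ _) (hV _ _)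
  have hu2 : V z μ * V (z + e μ) ν * (V (z + e ν) μ)⁻¹ ∈ unitaryUnits (Matrix n n ℂ) :=
    (unitaryUnits (Matrix n n ℂ)).mul_mem hu1 ((unitaryUnits (Matrix n n ℂ)).inv_mem (hV _ _))
  rw [curlAt_weight_eq, add_sub_cancel_left]
  have n2 : ‖(c (z + e μ) ν - c z μ) • Ad (V z μ * V (z + e μ) ν) (Y (z + e μ) ν)‖ ≤ ω * ‖Y (z + e μ) ν‖ := by
    rw [norm_smul, Real.norm_eq_abs, norm_Ad_of_unitary hu1]; exact mul_le_mul_of_nonneg_right h2 (norm_nonneg _)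
  have n3 : ‖(c (z + e ν) μ - c z μ) • Ad (V z μ * V (z + e μ) ν) (Y (z + e ν) μ)‖ ≤ ω * ‖Y (z + e ν) μ‖ := by
    rw [norm_smul, Real.norm_eq_abs, norm_Ad_of_unitary hu1]; exact mul_le_mul_of_nonneg_right h3 (norm_nonneg _)
  have n4 : ‖(c z ν - c z μ) • Ad (V z μ * V (z + e μ) ν * (V (z + e ν) μ)⁻¹) (Y z ν)‖ ≤ ω * ‖Y z ν‖ := by
    rw [norm_smul, Real.norm_eq_abs, norm_Ad_of_unitary hu2]; exact mul_le_mul_of_nonneg_right h4 (norm_nonneg _)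
  calc ‖(c (z + e μ) ν - c z μ) • Ad (V z μ * V (z + e μ) ν) (Y (z + e μ) ν)
          - (c (z + e ν) μ - c z μ) • Ad (V z μ * V (z + e μ) ν) (Y (z + e ν) μ)
          - (c z ν - c z μ) • Ad (V z μ * V (z + e μ) ν * (V (z + e ν) μ)⁻¹) (Y z ν)‖
      ≤ ‖(c (z + e μ) ν - c z μ) • Ad (V z μ * V (z + e μ) ν) (Y (z + e μ) ν)
          - (c (z + e ν) μ - c z μ) • Ad (V z μ * V (z + e μ) ν) (Y (z + e ν) μ)‖
        + ‖(c z ν - c z μ) • Ad (V z μ * V (z + e μ) ν * (V (z + e ν) μ)⁻¹) (Y z ν)‖ := norm_sub_le _ _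
    _ ≤ (‖(c (z + e μ) ν - c z μ) • Ad (V z μ * V (z + e μ) ν) (Y (z + e μ) ν)‖
          + ‖(c (z + e ν) μ - c z μ) • Ad (V z μ * V (z + e μ) ν) (Y (z + e ν) μ)‖)
        + ‖(c z ν - c z μ) • Ad (V z μ * V (z + e μ) ν * (V (z + e ν) μ)⁻¹) (Y z ν)‖ := by
          gcongr; exact norm_sub_le _ _
    _ ≤ (ω * ‖Y (z + e μ) ν‖ + ω * ‖Y (z + e ν) μ‖) + ω * ‖Y z ν‖ := by gcongr
    _ = ω * (‖Y (z + e μ) ν‖ + ‖Y (z + e ν) μ‖ + ‖Y z ν‖) := by ring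

/-- Hence `‖d_V(c·Y)(p)‖ ≤ |c(z,μ)|·‖d_V Y(p)‖ + ω·(‖Y(z+e_μ,ν)‖ + ‖Y(z+e_ν,μ)‖ + ‖Y(z,ν)‖)`. [folklore] -/
theorem norm_curlAt_weight_le [Nonempty n] {V : Site d → Fin d → (Matrix n n ℂ)ˣ} (hV : IsUnitaryCfg V) (c : Site d → Fin d → ℝ)
    (Y : Site d → Fin d → Matrix n n ℂ) (z : Site d) (μ ν : Fin d) {ω : ℝ}
    (h2 : |c (z + e μ) ν - c z μ| ≤ ω) (h3 : |c (z + e ν) μ - c z μ| ≤ ω) (h4 : |c z ν - c z μ| ≤ ω) :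
    ‖curlAt V (fun y κ => c y κ • Y y κ) z μ ν‖ ≤ |c z μ| * ‖curlAt V Y z μ ν‖ + ω * (‖Y (z + e μ) ν‖ + ‖Y (z + e ν) μ‖ + ‖Y z ν‖) := by
  have h := norm_curlAt_weight_sub_le hV c Y z μ ν h2 h3 h4
  have htri : ‖curlAt V (fun y κ => c y κ • Y y κ) z μ ν‖
      ≤ ‖c z μ • curlAt V Y z μ ν‖ + ‖curlAt V (fun y κ => c y κ • Y y κ) z μ ν - c z μ • curlAt V Y z μ ν‖ := by
    have := norm_add_le (c z μ • curlAt V Y z μ ν) (curlAt V (fun y κ => c y κ • Y y κ) z μ ν - c z μ • curlAt V Y z μ ν)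
    rwa [add_sub_cancel] at this
  rw [norm_smul, Real.norm_eq_abs] at htri
  linarith

end

end Summit.QuantumFields.BalabanUV.T4Continuum.NE7CutoffCurlLeibniz
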